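import Mathlib
import HarnessLib

/-!
# The `G₁`-vertex certificate: the matrix factorisation of `xw = zy³` and `y² ∉ ca` at its vertex
# (NEGATIVE-lane evidence at support level for the K4.4g kill probe of crux `HomologicalConductor.NoZenoR`,
# stmt-ResolutionOfSingularities-19943; nothing about the crux itself is refuted here)

Chain W4.4, kill probe K4.4g «KC-Nash» (counted 0): res-L0-w44-plan-1 RULING (ρ12b) 10:02:39Z =
res-L0-w44-idea-2's round-7 OFFER, file (2) of 2 — `L/res-L0-w44-idea-2/Sketch-idea-2-r7.lean`
3ed17969ad69852f §R7.2 VERBATIM (namespace = that of the sibling certificate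
`Theorems/Globalisation/Negative/A2CylinderCertificate.lean`; the FILE lives at the flat path
`Theorems/HomologicalConductorNoZenoG1VertexCertificate.lean` because the gate reserves
`Theorems/<Name>/Negative/` for `_false_of_` negative lemmas and refuses `--as helper` there;
consulting author in idea-2's stead: res-L0-w44-tri-2). `[OURS · L W4.4]` — elementary matrix identities and one polynomial-degree
argument, NOT a statement of the manuscript under review in cell res-hironaka and using none of its
statements; AI-written, weaker than expert review.

Object: the transversal threefold `Z_{G₁} = {xw = zy³}` of the non-simplicial 3-face
`G₁ = ⟨(1,0,0,0), (0,1,0,0), (1,0,0,1), (0,1,0,3)⟩` of the K4.4g cone `σ` (memo `DESCENT-KC.md`,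
idea-2). With `φ = [[x, y³], [z, w]]`, `ψ = [[w, −y³], [−z, x]]`:

* `g1Vertex_isMatrixFactorization` — `φ ψ = ψ φ = (xw − zy³)·1` (a rank-one matrix factorisation;
  `coker φ` is a maximal Cohen–Macaulay module of rank one over the hypersurface);
* `g1Vertex_homotopies` — `x, w, y³, z` act stably trivially on `coker φ` with CONSTANT homotopies
  `r·1 = φ K + N ψ` (so the stable annihilator of `coker φ` contains — indeed equals — `(x, w, y³, z)`);
* `g1Vertex_certificate` — for any ring map `ev : A → k[Y]` with `ev x = ev z = ev w = 0`, `ev y = Y`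
  and `ev r = c·Y²`, `c ≠ 0` («restrict to the `y`-axis»), there are NO `K, N` with
  `r·1 = φ K + N ψ` (the `(1,1)` entry restricts to `c·Y² = Y³·K₂₁(Y)`, absurd in degree `2`).
  With the homotopy criterion (Iyengar–Takahashi 2014, Rem. 2.13 / Lemma 2.14, tree
  `Literature.RingTheory.CohomologyAnnihilator.StableAnnihilation`) and 2-periodicity over the
  hypersurface this is `y² ∉ caⁿ((Z_{G₁})_𝔪)` for every `n` (paper wrapper exactly as in the sibling
  `A2CylinderCertificate.lean`), whence — by stratum descent (sibling file (1)
  `Theorems/HomologicalConductorNoZenoStratumDescent.lean`, face `G₁`, projection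
  `m ↦ (m₁, m₂, m₄)`) — `χ^{(0,2,0,0)}·tʲ ∉ caⁿ(R)` for all `n, j`: entry 7 of the T-A table of
  `DESCENT-KC.md`.
-/

-- single-problem summit: the doubled namespace component is forced
set_option linter.dupNamespace false
set_option autoImplicit false

namespace Summit.ResolutionOfSingularities.ResolutionOfSingularities.Theorems.Globalisation.Negative

section g1

variable {A : Type*} [CommRing A]

/-- `φ ψ = ψ φ = (xw − zy³)·1` for `φ = [[x, y³], [z, w]]`, `ψ = [[w, −y³], [−z, x]]`: a rank-one
matrix factorisation of the toric hypersurface `xw = zy³` (`coker φ ≅` the ideal `(x, z)`-class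
module, maximal Cohen–Macaulay of rank one). [cite: IyengarTakahashi2014, Example 2.8] -/
theorem g1Vertex_isMatrixFactorization (x y z w : A) :
    (!![x, y ^ 3; z, w] : Matrix (Fin 2) (Fin 2) A) * !![w, -(y ^ 3); -z, x] =
        (x * w - z * y ^ 3) • (1 : Matrix (Fin 2) (Fin 2) A) ∧
      (!![w, -(y ^ 3); -z, x] : Matrix (Fin 2) (Fin 2) A) * !![x, y ^ 3; z, w] =
        (x * w - z * y ^ 3) • (1 : Matrix (Fin 2) (Fin 2) A) := by
  constructor <;>
  · refine Matrix.ext fun i j => ?_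
    fin_cases i <;> fin_cases j <;> simp [Matrix.mul_apply, Fin.sum_univ_two] <;> ring

/-- `x, w, y³, z` act stably trivially on `coker φ`, with CONSTANT homotopies `r·1 = φ K + N ψ`:
the stable annihilator of `coker φ` contains `(x, w, y³, z)` (and, all entries of `φ, ψ` lying in
that ideal, equals it).  [cite: IyengarTakahashi2014, Remark 2.13] -/
theorem g1Vertex_homotopies (x y z w : A) :
    (x • (1 : Matrix (Fin 2) (Fin 2) A) =
        !![x, y ^ 3; z, w] * !![1, 0; 0, 0] + !![0, 0; 0, 1] * !![w, -(y ^ 3); -z, x]) ∧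
    (w • (1 : Matrix (Fin 2) (Fin 2) A) =
        !![x, y ^ 3; z, w] * !![0, 0; 0, 1] + !![1, 0; 0, 0] * !![w, -(y ^ 3); -z, x]) ∧
    (y ^ 3 • (1 : Matrix (Fin 2) (Fin 2) A) =
        !![x, y ^ 3; z, w] * !![0, 0; 1, 0] + !![0, 0; -1, 0] * !![w, -(y ^ 3); -z, x]) ∧
    (z • (1 : Matrix (Fin 2) (Fin 2) A) =
        !![x, y ^ 3; z, w] * !![0, 1; 0, 0] + !![0, -1; 0, 0] * !![w, -(y ^ 3); -z, x]) := by
  refine ⟨?_, ?_, ?_, ?_⟩ <;>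
  · refine Matrix.ext fun i j => ?_
    fin_cases i <;> fin_cases j <;> simp

/-- **The `G₁`-vertex certificate.**  Let `ev : A → k[Y]` be a ring map with `ev x = ev z = ev w = 0`,
`ev y = Y` ("restrict to the `y`-axis", the case in point being `A = k[x,y,z,w]` or any ring of
fractions of it with denominators not vanishing at the origin, after clearing them) and
`ev r = c·Y²` with `c ≠ 0` (e.g. `r = d·y²`, `d(0) = c ≠ 0`).  Then there are NO `K, N` with
`r·1 = φ K + N ψ`: the `(1,1)` entry restricts to `c·Y² = Y³·K₂₁(Y)`, absurd in degree `2`.  With the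
homotopy criterion this says `y²` is not stably trivial on `coker φ`, i.e. (2-periodicity over the
hypersurface `xw = zy³`) `y² ∉ caⁿ` at the vertex for every `n`.
[cite: IyengarTakahashi2014, Remark 2.13] -/
theorem g1Vertex_certificate {k : Type*} [CommRing k] (ev : A →+* Polynomial k) (x y z w r : A)
    (c : k) (hc : c ≠ 0) (hx : ev x = 0) (hz : ev z = 0) (hw : ev w = 0)
    (hy : ev y = Polynomial.X) (hr : ev r = Polynomial.C c * Polynomial.X ^ 2) :
    ¬ ∃ K N : Matrix (Fin 2) (Fin 2) A,
      r • (1 : Matrix (Fin 2) (Fin 2) A) = !![x, y ^ 3; z, w] * K + N * !![w, -(y ^ 3); -z, x] := by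
  rintro ⟨K, N, h⟩
  have h00 := congrArg (fun M : Matrix (Fin 2) (Fin 2) A => ev (M 0 0)) h
  have e1 : ((!![x, y ^ 3; z, w] : Matrix (Fin 2) (Fin 2) A) * K + N * !![w, -(y ^ 3); -z, x]) 0 0
      = x * K 0 0 + y ^ 3 * K 1 0 + (N 0 0 * w + N 0 1 * (-z)) := by
    rw [Matrix.add_apply, Matrix.mul_apply, Matrix.mul_apply]
    simp [Fin.sum_univ_two]
  have e2 : (r • (1 : Matrix (Fin 2) (Fin 2) A)) 0 0 = r := by simp
  simp only [e1, e2, map_add, map_mul, map_neg, map_pow, hx, hz, hw, hy, hr, zero_mul, mul_zero,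
    neg_zero, add_zero, zero_add] at h00
  -- h00 : C c * X ^ 2 = X ^ 3 * ev (K 1 0)
  have h2 := congrArg (fun p : Polynomial k => p.coeff 2) h00
  simp [Polynomial.coeff_X_pow_mul', Polynomial.coeff_C_mul, Polynomial.coeff_X_pow] at h2
  exact hc h2

end g1

end Summit.ResolutionOfSingularities.ResolutionOfSingularities.Theorems.Globalisation.Negative
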